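import Literature.NumberTheory.Automorphic.HilbertRepSpectrumProofs   -- ★ `ClosedSubrep`, `toContRep`, `AreUnitarilyEquivalent`
import HarnessLib

/-!
# A finite orthogonal family of closed subrepresentations, each unitarily equivalent to one `τ`, IS an isotypic block
# (the data `U : σ → (V →ₗᵢ E)` of ★ `HilbertRepIsotypicBlockTrace`)

Topic `NumberTheory/Automorphic`; namespace `ContRepresentation` (dot-notation extensions of Mathlib's `ContRepresentation`, as ★ `HilbertRepIsotypicBlockTrace`,
★ `HilbertRepCharacterTransport`).  THEOREMS ONLY (no definition, no instance, no notation, no named fact, no `sorry`).  Cell `hodgecm-mathlib`, F0∕P3, ROAD «TF»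
(letter #84, residual `ArchFinTraceSplit`): plumbing between the H3 structure statement (SPEC «J2» `F0/P3/F0P3-p01/g11/SPEC-J2-…md` §3 (a): «finitely many pairwise
orthogonal irreducible blocks `W_i` of `π′^{K′}`, each ≃ the globalization `τ`») and the HYPOTHESES of ★ H2 `ContRepresentation.exists_matrix_hasSum_inner_comp`
(isometries `U_i : V →ₗᵢ E` intertwining `τ` with `π`, pairwise orthogonal ranges).

THE STATEMENT (`ClosedSubrep.exists_blockIsometries_of_areUnitarilyEquivalent`).  Let `π` be a representation of `G` on the Hilbert space `E`, `τ` one on `V`, and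
`W : σ → ClosedSubrep π` a family of closed invariant subspaces with PAIRWISE ORTHOGONAL carriers, each `W i` unitarily equivalent to `τ`
(★ `AreUnitarilyEquivalent τ (W i).toContRep`).  Then there are linear isometries `U i : V →ₗᵢ[ℂ] E` with `U i (τ g v) = π g (U i v)`, pairwise orthogonal ranges
(`⟪U i v, U j w⟫ = 0` for `i ≠ j`), and `range (U i) = W i` — i.e. exactly the block data of ★ `HilbertRepIsotypicBlockTrace` §2–§3 [DeitmarEchterhoff2014, §7.3;
Gelbart1975, Lemma 10.6].  (`U i` = the inclusion of `W i` composed with the isometric equivalence; Mathlib `Isometry.norm_map_of_map_zero`,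
`Submodule.subtypeₗᵢ`.)

## Mathlib ∕ tree search
Tree: ★ `HilbertRepIsotypicBlockTrace` (p838187, consumes this data), ★ `HilbertRepSpectrum(Proofs)` (`ClosedSubrep`, `coe_toContRep_apply`, `AreUnitarilyEquivalent`), ★
`HilbertRepCharacterTransport` :82 (the `LinearIsometryEquiv` from an isometric `ContRepresentation.Equiv` — same three lines).  Mathlib: `Submodule.subtypeₗᵢ`,
`LinearIsometry.comp`, `Submodule.isOrtho_iff_inner_eq`.  Dedup: `rg "blockIsometries|exists_isometries_of_areUnitarilyEquivalent" Literature/ Summits/` — no hits.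

## References
* A. Deitmar, S. Echterhoff, *Principles of Harmonic Analysis*, 2nd ed. (2014), §7.3 (isotypic components, Thm. 7.3.2) [DeitmarEchterhoff2014].
* S. Gelbart, *Automorphic Forms on Adele Groups* (1975), Lemma 10.6 [Gelbart1975].
* J. Dixmier, *C\*-algebras* (1977), §13.1.3 [Dixmier1977].
-/

set_option autoImplicit false

noncomputable section

open scoped InnerProductSpace

namespace ContRepresentation

variable {G : Type*} [Group G]
  {E : Type*} [NormedAddCommGroup E] [InnerProductSpace ℂ E]
  {V : Type*} [NormedAddCommGroup V] [InnerProductSpace ℂ V]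
  {π : ContRepresentation ℂ G E} {τ : ContRepresentation ℂ G V}

/-- **One closed subrepresentation unitarily equivalent to `τ` gives one intertwining isometry onto it**: from `τ ≃ᵤ W.toContRep` an isometry `U : V →ₗᵢ E`
with `U (τ g v) = π g (U v)` and `range U = W`. [cite: Dixmier1977, §13.1.3] [cite: DeitmarEchterhoff2014, §7.3 Thm. 7.3.2] -/
theorem ClosedSubrep.exists_isometry_of_areUnitarilyEquivalent (W : ClosedSubrep π) (h : AreUnitarilyEquivalent τ W.toContRep) :
    ∃ U : V →ₗᵢ[ℂ] E, (∀ (g : G) (v : V), U (τ g v) = π g (U v)) ∧ LinearMap.range U.toLinearMap = W.toSubmodule := by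
  obtain ⟨e, he⟩ := h
  -- the isometric equivalence `V ≃ₗᵢ W`
  let e' : V ≃ₗᵢ[ℂ] W.toSubmodule :=
    { (e.toContinuousLinearEquiv : V ≃L[ℂ] W.toSubmodule).toLinearEquiv with
      norm_map' := fun v => he.norm_map_of_map_zero (map_zero e) v }
  have he' : ∀ v, e' v = e v := fun v => rfl
  refine ⟨W.toSubmodule.subtypeₗᵢ.comp e'.toLinearIsometry, fun g v => ?_, ?_⟩
  · change ((e' (τ g v) : W.toSubmodule) : E) = π g ((e' v : W.toSubmodule) : E)
    rw [he', he', ← ClosedSubrep.coe_toContRep_apply]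
    congr 1
    exact e.toContIntertwiningMap.isIntertwining g v
  · apply le_antisymm
    · rintro _ ⟨v, rfl⟩
      exact (e' v).2
    · intro w hw
      refine ⟨e'.symm ⟨w, hw⟩, ?_⟩
      change ((e' (e'.symm ⟨w, hw⟩) : W.toSubmodule) : E) = w
      rw [LinearIsometryEquiv.apply_symm_apply]

/-- **A FINITE (or arbitrary) ORTHOGONAL FAMILY OF CLOSED SUBREPRESENTATIONS, EACH UNITARILY EQUIVALENT TO `τ`, IS AN ISOTYPIC BLOCK**: there are isometries
`U i : V →ₗᵢ[ℂ] E` intertwining `τ` with `π`, with pairwise orthogonal ranges, and `range (U i) = W i` — the hypotheses `hUτ`, `hU` of ★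
`ContRepresentation.exists_matrix_hasSum_inner_comp` (H2). [cite: DeitmarEchterhoff2014, §7.3 Thm. 7.3.2] [cite: Gelbart1975, Lemma 10.6] -/
theorem ClosedSubrep.exists_blockIsometries_of_areUnitarilyEquivalent {σ : Type*} (W : σ → ClosedSubrep π)
    (hW : ∀ i, AreUnitarilyEquivalent τ (W i).toContRep) (horth : ∀ i j, i ≠ j → (W i).toSubmodule ⟂ (W j).toSubmodule) :
    ∃ U : σ → (V →ₗᵢ[ℂ] E), (∀ (i : σ) (g : G) (v : V), U i (τ g v) = π g (U i v)) ∧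
      (∀ i j, i ≠ j → ∀ v w : V, ⟪U i v, U j w⟫_ℂ = 0) ∧ ∀ i, LinearMap.range (U i).toLinearMap = (W i).toSubmodule := by
  choose U hUτ hUr using fun i => (W i).exists_isometry_of_areUnitarilyEquivalent (hW i)
  refine ⟨U, hUτ, fun i j hij v w => ?_, hUr⟩
  have hv : U i v ∈ (W i).toSubmodule := by rw [← hUr i]; exact ⟨v, rfl⟩
  have hw : U j w ∈ (W j).toSubmodule := by rw [← hUr j]; exact ⟨w, rfl⟩
  exact (Submodule.isOrtho_iff_inner_eq.mp (horth i j hij)) _ hv _ hw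

/-- The block spanned by the family: `⨆ i, range (U i) = ⨆ i, W i` (bookkeeping for H2's `hBU` ∕ H1's block). [cite: DeitmarEchterhoff2014, §7.3 Thm. 7.3.2] -/
theorem ClosedSubrep.iSup_range_eq_of_range_eq {σ : Type*} (W : σ → ClosedSubrep π) (U : σ → (V →ₗᵢ[ℂ] E))
    (hUr : ∀ i, LinearMap.range (U i).toLinearMap = (W i).toSubmodule) :
    (⨆ i, LinearMap.range (U i).toLinearMap) = ⨆ i, (W i).toSubmodule :=
  iSup_congr hUr

end ContRepresentation

end
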